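import Summits.AtomisticToContinuum.HydrodynamicLimit.Theorems.InformationPercolationEngineChaosClosesEulerLocalEquilibriumFromDissipationI
import Summits.AtomisticToContinuum.HydrodynamicLimit.Theorems.InformationPercolationEngineChaosClosesEulerCollisionMomentUI
import Summits.AtomisticToContinuum.HydrodynamicLimit.Theses.TwoClocks
import Summits.AtomisticToContinuum.HydrodynamicLimit.Theses.LimitCollisionMeasure
import Literature.Analysis.FluidPDE.BoltzmannEquation
import HarnessLib

/-!
# Pointwise local equilibrium from the empirical H-theorem (assembly)

Helper for the line `empirical-h-theorem` (crux-strategist s2; adopted by the lead after the line `Sketch` completed) of the crux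
`InformationPercolationEngine.ChaosClosesEuler` (stmt-AtomisticToContinuum-15141), skeleton
`Cruxes/ChaosClosesEuler/Lines/empirical_h_theorem.lean`, registered stub `stub_localEquilibriumFromDissipation`: `WindowedEntropyBalance → PointwiseEntropicChaos → DissipationRigidity → TwoClocks.EnergyCurrentTails → LimitCollisionMeasure.CollisionTightness → PointwiseLocalEquilibrium` with all bodies inlined VERBATIM from the skeleton defs.

PROOF. `η₀ := min(η_E, η_Y)/2` (`η_E` the band of pointwise entropic chaos, `η_Y` the band on which the contact value
`Y = (3/2π) f_ex′ ∈ [1/2, 3/2]`, `exists_contactBand` from the proved `HsEosLowDensity`); `σ₀ :=` the least of the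
thresholds of entropic chaos, of the cubic tails, of quartic tightness, of the collision-moment uniform integrability
(`ChaosClosesEulerCollisionMomentUI.stub_collisionMomentUI`, landed, from `CollisionTightness`) and `1/2`; at fixed
`(σ, T, ρ, θ, u, Φ, t)` the estimate in probability is `localEquilibrium_inProbability` (helper I; helpers A–H: the
smoothed log-density and its log growth, Boltzmann's inequality for the cut functionals, the cone law as a measure and
dissipation rigidity on it, the collision side and the cost of the pair-energy cut, the fields along a good orbit,
positivity transfer, the deterministic core, the data and budgets).  The `let`s of the statement are DEFINITIONALLY the
tree's `cone/rhoC/momC/kinC/thetaC/uC/MpsiC` and the helpers' `kentW/krW/rW/csum/pvel/markI/LamC/PredC/DissC`.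

References: lead/strategist notes `Cruxes/ChaosClosesEuler/NOTES.md` §G, line card `Lines/empirical-h-theorem.md`;
C. Cercignani, R. Illner, M. Pulvirenti, *The Mathematical Theory of Dilute Gases* (1994) §3.1–3.3.
-/

noncomputable section

namespace Summit.AtomisticToContinuum.HydrodynamicLimit.Theorems.ChaosClosesEulerLocalEquilibriumFromDissipation

open scoped BigOperators Topology Classical MeasureTheory ENNReal InnerProductSpace
open Filter Set MeasureTheory
open Literature.MathematicalPhysics.KineticTheory
open Literature.Analysis.FluidPDE
open Summit.AtomisticToContinuum.HydrodynamicLimit.Theses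
open Summit.AtomisticToContinuum.HydrodynamicLimit.Theses.InformationPercolationEngine

/-- Registered stub `stub_localEquilibriumFromDissipation` of the line `empirical-h-theorem` (crux stmt-AtomisticToContinuum-15141): `WindowedEntropyBalance → PointwiseEntropicChaos → DissipationRigidity → TwoClocks.EnergyCurrentTails → LimitCollisionMeasure.CollisionTightness → PointwiseLocalEquilibrium` with all bodies inlined VERBATIM from the skeleton defs. [folklore] -/
theorem stub_localEquilibriumFromDissipation :
    (∀ (σ : ℝ), 0 < σ → σ < 2⁻¹ → ∀ (τ r δ K : ℝ), 0 < τ → 0 < r → 0 < δ →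
        ∀ (h : ℝ → ℝ) (Ch Lh : ℝ), 0 ≤ Ch → 0 ≤ Lh → (∀ a, |h a| ≤ Ch) → (∀ a b, |h a - h b| ≤ Lh * |a - b|) →
        ∃ C₁ C₂ : ℝ, ∀ (N : ℕ) (Φ : HardSphereFlow (Torus.geometry (Fin 3)) (hsDiameter σ N) (N + 1)),
        ∀ z ∈ Φ.good, ∀ (t₀ : ℝ) (x₀ : T3),
        let ε := hsDiameter σ N
        let Gm : Geometry (Fin 3) T3 := Torus.geometry (Fin 3)
        let γ : ℝ → Config (N + 1) (Fin 3) T3 := fun s => Φ.flow s z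
        let bx : T3 → T3 → ℝ := fun y x => 3 / (Real.pi * r ^ 3) * max (1 - Torus.euclidDist y x / r) 0
        let bt : ℝ → ℝ := fun a => r⁻¹ * max (1 - |a| / r) 0
        let ρm : Config (N + 1) (Fin 3) T3 → T3 → ℝ := fun w x => ∫ q, bx q.1 x ∂(empiricalMeasure w)
        let φδ : V3 → ℝ := fun v => localMaxwellian 1 (δ ^ 2) 0 v
        let y₀ : V3 → ℝ := fun v => Real.exp (-K) * ((1 + ‖v‖ ^ 2) ^ 2)⁻¹
        let ℓK : V3 → ℝ → ℝ := fun v y => if y₀ v ≤ y then Real.log y else Real.log (y₀ v) + (y - y₀ v) / y₀ v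
        let g : Config (N + 1) (Fin 3) T3 → T3 → V3 → ℝ := fun w x v =>
          ∫ q, bx q.1 x * φδ (v - q.2) ∂(empiricalMeasure w)
        let Λt : Config (N + 1) (Fin 3) T3 → T3 → V3 → ℝ := fun w x v => ∫ u, φδ (v - u) * ℓK u (g w x u)
        let pv : ℝ → Fin (N + 1) → Fin (N + 1) → V3 × V3 := fun s i j =>
          reflectVel (Gm.sepVec (γ s i).1 (γ s j).1) ((γ s i).2, (γ s j).2)
        let Kent : ℝ := ε / (N + 1 : ℝ) * ∑ᶠ (s : ℝ) (_ : s ∈ collisionTimes Gm ε γ ∩ Set.Icc 0 τ),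
            ∑ i : Fin (N + 1), ∑ j : Fin (N + 1),
              (if i ≠ j ∧ ‖Gm.sepVec (γ s i).1 (γ s j).1‖ = ε then
                bt (s - t₀) * ∫ x, bx x x₀ * h (ρm (γ s) x) * bx (γ s i).1 x *
                  (Λt (γ s) x (pv s i j).1 - Λt (γ s) x (γ s i).2) else 0)
        let Q4 : ℝ := ε / (N + 1 : ℝ) * ∑ᶠ (s : ℝ) (_ : s ∈ collisionTimes Gm ε γ ∩ Set.Icc 0 τ),
            ∑ i : Fin (N + 1), ∑ j : Fin (N + 1),
              (if i ≠ j ∧ ‖Gm.sepVec (γ s i).1 (γ s j).1‖ = ε then 1 + ‖(γ s i).2‖ ^ 4 + ‖(γ s j).2‖ ^ 4 else 0)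
        |Kent| ≤ ε * C₁ * (1 + configEnergy z / (N + 1 : ℝ)) ^ 3 + C₂ * Q4 / (N + 1 : ℝ)) →
    (∃ η₀ : ℝ, 0 < η₀ ∧ ∀ (a₀ θ₀ : T3 → ℝ) (u₀ : T3 → V3), Continuous a₀ → Continuous θ₀ → Continuous u₀ →
        (∀ x, 0 < a₀ x) → (∀ x, 0 < θ₀ x) → ∃ σ₀ : ℝ, 0 < σ₀ ∧ ∀ σ : ℝ, 0 < σ → σ < σ₀ →
        ∀ Φ : (N : ℕ) → HardSphereFlow (Torus.geometry (Fin 3)) (hsDiameter σ N) (N + 1),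
        ∀ τ : ℝ, 0 < τ → ∀ δ : ℝ, 0 < δ →
        ∀ h : ℝ → ℝ, Continuous h → (∃ C : ℝ, ∀ a, |h a| ≤ C) → (∀ a : ℝ, η₀ ≤ σ ^ 3 * a → h a = 0) →
        ∀ η δ' : ℝ, 0 < η → 0 < δ' → ∃ K₀ : ℝ, ∀ K : ℝ, K₀ ≤ K → ∃ L₀ : ℝ, ∀ L : ℝ, L₀ ≤ L →
        ∃ r₀ : ℝ, 0 < r₀ ∧ ∀ r : ℝ, 0 < r → r < r₀ → ∃ N₀ : ℕ, ∀ N : ℕ, N₀ ≤ N →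
        let ε := hsDiameter σ N
        let Gm : Geometry (Fin 3) T3 := Torus.geometry (Fin 3)
        let γ : Config (N + 1) (Fin 3) T3 → ℝ → Config (N + 1) (Fin 3) T3 := fun z s => (Φ N).flow s z
        let bx : T3 → T3 → ℝ := fun y x => 3 / (Real.pi * r ^ 3) * max (1 - Torus.euclidDist y x / r) 0
        let bt : ℝ → ℝ := fun a => r⁻¹ * max (1 - |a| / r) 0
        let ρm : Config (N + 1) (Fin 3) T3 → T3 → ℝ := fun w x => ∫ q, bx q.1 x ∂(empiricalMeasure w)
        let φδ : V3 → ℝ := fun v => localMaxwellian 1 (δ ^ 2) 0 v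
        let y₀ : V3 → ℝ := fun v => Real.exp (-K) * ((1 + ‖v‖ ^ 2) ^ 2)⁻¹
        let ℓK : V3 → ℝ → ℝ := fun v y => if y₀ v ≤ y then Real.log y else Real.log (y₀ v) + (y - y₀ v) / y₀ v
        let g : Config (N + 1) (Fin 3) T3 → T3 → V3 → ℝ := fun w x v =>
          ∫ q, bx q.1 x * φδ (v - q.2) ∂(empiricalMeasure w)
        let Λt : Config (N + 1) (Fin 3) T3 → T3 → V3 → ℝ := fun w x v => ∫ u, φδ (v - u) * ℓK u (g w x u)
        let Gt : Config (N + 1) (Fin 3) T3 → T3 → V3 → ℝ := fun w x v => Real.exp (Λt w x v)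
        let Θ : Config (N + 1) (Fin 3) T3 → T3 → V3 → V3 → ℝ := fun w x v u =>
          ∫ ω : Metric.sphere (0 : V3) 1,
            (Λt w x v - Λt w x (collide ω (v, u)).1) * hardSphereKernel (u, v) ω ∂sphereMeasure
        let cut : V3 → V3 → ℝ := fun v u => if ‖v‖ ^ 2 + ‖u‖ ^ 2 ≤ L then 1 else 0
        let Pred : Config (N + 1) (Fin 3) T3 → T3 → ℝ := fun w x =>
          ∫ v, ∫ u, cut v u * Θ w x v u * (Gt w x v * Gt w x u)
        let pv : Config (N + 1) (Fin 3) T3 → ℝ → Fin (N + 1) → Fin (N + 1) → V3 × V3 := fun z s i j =>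
          reflectVel (Gm.sepVec (γ z s i).1 (γ z s j).1) ((γ z s i).2, (γ z s j).2)
        let Y : ℝ → ℝ := fun a => 3 / (2 * Real.pi) * deriv hsExcessFreeEnergy a
        let Kr : Config (N + 1) (Fin 3) T3 → ℝ → T3 → ℝ := fun z t₀ x₀ =>
          ε / (N + 1 : ℝ) * ∑ᶠ (s : ℝ) (_ : s ∈ collisionTimes Gm ε (γ z) ∩ Set.Icc 0 τ),
            ∑ i : Fin (N + 1), ∑ j : Fin (N + 1),
              (if i ≠ j ∧ ‖Gm.sepVec (γ z s i).1 (γ z s j).1‖ = ε then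
                bt (s - t₀) * cut (pv z s i j).1 (pv z s i j).2 *
                  ∫ x, bx x x₀ * h (ρm (γ z s) x) * bx (γ z s i).1 x *
                    (Λt (γ z s) x (pv z s i j).1 - Λt (γ z s) x (γ z s i).2) else 0)
        let R : Config (N + 1) (Fin 3) T3 → ℝ → T3 → ℝ := fun z t₀ x₀ =>
          σ ^ 3 * ∫ s in Set.Icc 0 τ, bt (s - t₀) *
            ∫ x, bx x x₀ * (h (ρm (γ z s) x) * Y (σ ^ 3 * ρm (γ z s) x) * Pred (γ z s) x)
        localGibbsLaw σ a₀ u₀ θ₀ N (Φ N)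
          {z | η < ∫ t₀ in Set.Icc 0 τ, ∫ x₀, |Kr z t₀ x₀ - R z t₀ x₀|} ≤ ENNReal.ofReal δ') →
    (∀ (Lt : ℕ → ℝ) (ρ₁ ρ₂ θ₁ : ℝ), 0 < ρ₁ → 0 < θ₁ →
        ∀ ψ : V3 → ℝ, Continuous ψ → (∃ C : ℝ, ∀ v, |ψ v| ≤ C) → ∀ δ : ℝ, 0 < δ → ∀ ε : ℝ, 0 < ε →
        ∃ η : ℝ, 0 < η ∧ ∃ K₁ : ℝ, ∀ K : ℝ, K₁ ≤ K → ∃ L₁ : ℝ, ∀ L : ℝ, L₁ ≤ L → ∃ n : ℕ,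
        ∀ m : Measure V3, IsFiniteMeasure m → Integrable (fun v : V3 => ‖v‖ ^ 2) m →
          ρ₁ ≤ (m Set.univ).toReal → (m Set.univ).toReal ≤ ρ₂ →
          (∀ j : ℕ, j ≤ n → ∫ v in {v : V3 | Lt j < ‖v‖}, ‖v‖ ^ 2 ∂m ≤ 1 / ((j : ℝ) + 1)) →
        let φδ : V3 → ℝ := fun v => localMaxwellian 1 (δ ^ 2) 0 v
        let y₀ : V3 → ℝ := fun v => Real.exp (-K) * ((1 + ‖v‖ ^ 2) ^ 2)⁻¹
        let ℓK : V3 → ℝ → ℝ := fun v y => if y₀ v ≤ y then Real.log y else Real.log (y₀ v) + (y - y₀ v) / y₀ v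
        let g : V3 → ℝ := fun v => ∫ w, φδ (v - w) ∂m
        let Λt : V3 → ℝ := fun v => ∫ u, φδ (v - u) * ℓK u (g u)
        let Gt : V3 → ℝ := fun v => Real.exp (Λt v)
        let cut : V3 → V3 → ℝ := fun v u => if ‖v‖ ^ 2 + ‖u‖ ^ 2 ≤ L then 1 else 0
        let D : ℝ := ∫ v, ∫ u, cut v u * (∫ ω : Metric.sphere (0 : V3) 1,
            (Λt v + Λt u - Λt (collide ω (v, u)).1 - Λt (collide ω (v, u)).2) * hardSphereKernel (u, v) ω
              ∂sphereMeasure) * (Gt v * Gt u)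
        let ρm : ℝ := (m Set.univ).toReal
        let um : V3 := ρm⁻¹ • ∫ v, v ∂m
        let θm : ℝ := 2 / 3 * ((∫ v, ‖v‖ ^ 2 / 2 ∂m) / ρm - ‖∫ v, v ∂m‖ ^ 2 / (2 * ρm ^ 2))
        θ₁ ≤ θm → D ≤ η → |(∫ v, ψ v ∂m) - ρm * ∫ v, ψ v * localMaxwellian 1 θm um v| ≤ ε) →
    TwoClocks.EnergyCurrentTails → LimitCollisionMeasure.CollisionTightness →
    ∃ η₀ : ℝ, 0 < η₀ ∧ ∀ (a₀ θ₀ : T3 → ℝ) (u₀ : T3 → V3), Continuous a₀ → Continuous θ₀ → Continuous u₀ →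
      (∀ x, 0 < a₀ x) → (∀ x, 0 < θ₀ x) → ∃ σ₀ : ℝ, 0 < σ₀ ∧ ∀ σ : ℝ, 0 < σ → σ < σ₀ →
      ∀ (T : ℝ) (ρ θ : ℝ → T3 → ℝ) (u : ℝ → T3 → V3), IsHardSphereEulerSolution σ T ρ u θ →
      ∀ Φ : (N : ℕ) → HardSphereFlow (Torus.geometry (Fin 3)) (hsDiameter σ N) (N + 1),
      TendstoHydroFieldsAt (fun N => localGibbsLaw σ a₀ u₀ θ₀ N (Φ N)) Φ ρ u θ 0 →
      ∀ t ∈ Set.Ico 0 T, ∀ ψ : V3 → ℝ, Continuous ψ → (∃ C : ℝ, ∀ v, |ψ v| ≤ C) →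
      ∀ h : ℝ × V3 × ℝ → ℝ, Continuous h → (∃ C : ℝ, ∀ p, |h p| ≤ C) →
      (∃ ρ₁ θ₁ Θ U : ℝ, 0 < ρ₁ ∧ 0 < θ₁ ∧ ∀ p : ℝ × V3 × ℝ,
        (p.1 ≤ ρ₁ ∨ η₀ ≤ σ ^ 3 * p.1 ∨ p.2.2 ≤ θ₁ ∨ Θ ≤ p.2.2 ∨ U ≤ ‖p.2.1‖) → h p = 0) →
      ∀ η δ : ℝ, 0 < η → 0 < δ → ∃ r₀ : ℝ, 0 < r₀ ∧ ∀ r : ℝ, 0 < r → r < r₀ → ∃ N₀ : ℕ, ∀ N : ℕ, N₀ ≤ N →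
      let bx : T3 → T3 → ℝ := fun y x => 3 / (Real.pi * r ^ 3) * max (1 - Torus.euclidDist y x / r) 0
      let ρm : Config (N + 1) (Fin 3) T3 → T3 → ℝ := fun w x₀ => ∫ q, bx q.1 x₀ ∂(empiricalMeasure w)
      let mm : Config (N + 1) (Fin 3) T3 → T3 → V3 := fun w x₀ => ∫ q, bx q.1 x₀ • q.2 ∂(empiricalMeasure w)
      let em : Config (N + 1) (Fin 3) T3 → T3 → ℝ := fun w x₀ =>
        ∫ q, bx q.1 x₀ * (‖q.2‖ ^ 2 / 2) ∂(empiricalMeasure w)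
      let um : Config (N + 1) (Fin 3) T3 → T3 → V3 := fun w x₀ => (ρm w x₀)⁻¹ • mm w x₀
      let θm : Config (N + 1) (Fin 3) T3 → T3 → ℝ := fun w x₀ =>
        2 / 3 * (em w x₀ / ρm w x₀ - ‖mm w x₀‖ ^ 2 / (2 * ρm w x₀ ^ 2))
      let Mψ : Config (N + 1) (Fin 3) T3 → T3 → ℝ := fun w x₀ => ∫ q, bx q.1 x₀ * ψ q.2 ∂(empiricalMeasure w)
      localGibbsLaw σ a₀ u₀ θ₀ N (Φ N)
        {z | η < ∫ s in Set.Icc 0 t, ∫ x,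
          |h (ρm ((Φ N).flow s z) x, um ((Φ N).flow s z) x, θm ((Φ N).flow s z) x)| *
            |Mψ ((Φ N).flow s z) x - ρm ((Φ N).flow s z) x *
              ∫ v, ψ v * localMaxwellian 1 (θm ((Φ N).flow s z) x) (um ((Φ N).flow s z) x) v|} ≤ ENNReal.ofReal δ := by
  intro hWEB hPEnC hDR hECT hCT
  obtain ⟨ηE, hηE, HPE⟩ := hPEnC
  obtain ⟨ηY, hηY, hYb⟩ := exists_contactBand
  refine ⟨min ηE ηY / 2, div_pos (lt_min hηE hηY) two_pos, fun a₀ θ₀ u₀ ha hθ hu ha0 hθ0 => ?_⟩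
  obtain ⟨σE, hσE, HPE1⟩ := HPE a₀ θ₀ u₀ ha hθ hu ha0 hθ0
  obtain ⟨σT, hσT, HT1⟩ := hECT a₀ θ₀ u₀ ha hθ hu ha0 hθ0
  obtain ⟨σB, hσB, HB1⟩ := hCT a₀ θ₀ u₀ ha hθ hu ha0 hθ0
  obtain ⟨σC, hσC, HC1⟩ := ChaosClosesEulerCollisionMomentUI.stub_collisionMomentUI hCT a₀ θ₀ u₀ ha hθ hu ha0 hθ0
  refine ⟨min (min σE σT) (min (min σB σC) 2⁻¹),
    lt_min (lt_min hσE hσT) (lt_min (lt_min hσB hσC) (by norm_num)),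
    fun σ hσ hσlt T ρ θ u hsol Φ htie t ht ψ hψc hψb h _hhc hhb hsupp η δ hη hδ => ?_⟩
  have hσE' : σ < σE := hσlt.trans_le ((min_le_left _ _).trans (min_le_left _ _))
  have hσT' : σ < σT := hσlt.trans_le ((min_le_left _ _).trans (min_le_right _ _))
  have hσB' : σ < σB := hσlt.trans_le ((min_le_right _ _).trans ((min_le_left _ _).trans (min_le_left _ _)))
  have hσC' : σ < σC := hσlt.trans_le ((min_le_right _ _).trans ((min_le_left _ _).trans (min_le_right _ _)))
  have hσ2 : σ < 2⁻¹ := hσlt.trans_le ((min_le_right _ _).trans (min_le_right _ _))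
  -- the estimate in probability at fixed `(σ, t)` (helper I), fed with the five hypotheses specialised at `σ`; the
  -- `let`s of the statement are definitionally the helpers' `kentW, krW, rW, csum` and the tree's cone fields
  exact localEquilibrium_inProbability hσ hσ2 ha hθ hu ha0 hθ0 Φ ht.1 (η₁ := min ηE ηY) (lt_min hηE hηY)
    (min_le_left _ _) (min_le_right _ _) hYb (hWEB σ hσ hσ2) (HPE1 σ hσ hσE' Φ) hDR
    (HT1 σ hσ hσT' T ρ θ u hsol Φ htie t ht) (HB1 σ hσ hσB' Φ) (HC1 σ hσ hσC' Φ) ψ hψc hψb h hhb hsupp hη hδ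

/-- **Registered anchor `stub_localEquilibriumFromDissipationAnchor`** (bookkeeping anchor of this file: the registry
cannot hold the inlined signature of `stub_localEquilibriumFromDissipation`; same device as
`ChaosClosesEulerDock.stub_dockAnchor` / `ChaosClosesEulerPressureValue.stub_pressureValueP`): the shape of the
assembly `WEB → PEnC → DR → ECT → CT → PLE`. [folklore] -/
theorem stub_localEquilibriumFromDissipationAnchor : ∀ (WEB PEnC DR ECT CT PLE : Prop), (WEB → PEnC → DR → ECT → CT → PLE) → ECT → CT → WEB → PEnC → DR → PLE :=
  fun _ _ _ _ _ _ h hE hC hW hP hD => h hW hP hD hE hC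

end Summit.AtomisticToContinuum.HydrodynamicLimit.Theorems.ChaosClosesEulerLocalEquilibriumFromDissipation
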